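import Mathlib.Analysis.Analytic.Basic
import Literature.NumberTheory.Automorphic.GKModules
import HarnessLib

/-!
# The `K`-action underlying a representation of a linear real group (`restrictK`), and the
# retired named fact on analyticity of `K`-finite vectors (Harish-Chandra)

Topic `NumberTheory/Automorphic`; sibling of `GKModules` (Harish-Chandra's admissibility and
irreducibility theorems for unitary representations of a linear real group
`G : RealMatrixGroup A N`). What this file (still) provides:

* `restrictK G ϖ` — the bare `Representation` of `K = G.maximalCompact = G ∩ U(N, A)` on `E`
  underlying `ϖ : ContRepresentation ℂ G.carrier E` (Mathlib `ContRepresentation.restrict` along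
  `K ≤ G`, then `toRepresentation`): the argument `IsAdmissibleGK` of `GKModules` expects, with
  `restrictK_apply` (definitional) and `kOrbitSpan_eq_span_range_restrictK` (the `K`-orbit spans
  `kOrbitSpan`/`kFiniteVectors` of `GKModules` are spans of orbits of exactly this action). It is
  used by `AutomorphicRepsGLCuspidalL2Step3a` (`restrictK_toContRep_levelFixedArch`: the
  `K_∞`-action on `Π^U ≤ L²_cusp(GL_n)` is definitionally the representation of the admissibility
  fact `isAdmissibleGK_cuspidal_levelFixed`).

## The retired fact (D-0026 review of the split, 2026-08-15)

The accepted version of this file (p22174) also declared the named fact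
`analyticOnNhd_expMem_smul_of_mem_kFiniteVectors G ϖ`: for `A` finite-dimensional star-formally
real (so `K` compact), `G = K exp 𝔭`, and `ϖ` a strongly continuous unitary representation of `G`
on a Hilbert space whose `K`-action has finite multiplicities (`IsAdmissibleGK (restrictK G ϖ)`),
every `K`-finite vector `v` is analytic along every one-parameter subgroup,
`AnalyticOnNhd ℝ (t ↦ ϖ (exp tX) v) univ` for `X ∈ 𝔤`. This is (the one-parameter weakening of)
a classical theorem — Harish-Chandra 1953, Lemma 34 (p. 228: for a permissible representation
with `dim ℌ_𝔇 < ∞` for every class `𝔇` of `K`-types, every vector of `∑ ℌ_𝔇` is well-behaved),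
proved there from the density of well-behaved vectors (Thm. 4) and Lemma 31; Libine 2012
(Schmid's course), Thm. 58 (b) / Thm. 72 (`V_fini ⊆ V^ω` for admissible `V`, linear connected
semisimple `G`), where the printed route is analytic elliptic regularity for `Ω_G − 2Ω_K`
(remark after Cor. 66); Knapp 1986, Ch. VIII, §§2–3 (linear connected reductive `G`). The statement was
checked faithful (and weaker than print) at review; it is NOT withdrawn as wrong.

It is retired, unproved, because it was minted as a decomposition child of the `GL_n`-specific
analyticity leaf of Borel–Jacquet 4.6, Step 3a (`AutomorphicRepsGL.formsOfL2_coeff_analyticAt`,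
`AutomorphicRepsGL.formsOfL2_closure_exp_invariant`), and as such it was mis-cut: a theory-sized
child (for a general linear real group its proof needs, besides the smooth-vector calculus of
`GKModulesSmoothVectorsProofs`, that `K`-finite vectors of admissible representations are smooth —
Gårding smoothing on `G` and the isotypic projectors `∫_K \overline{χ_τ} ϖ(k) dk`, i.e. Schur
orthogonality on `K` — and a Casimir element for a general `Ad`-stable `𝔤 ≤ 𝔤𝔩(N, A)`, before
either elliptic regularity or Nelson's estimate can be run) serving a parent that the tree
meanwhile proves by a shorter printed route: for cusp forms on `GL_n` the analyticity of the
`L²`-orbits `t ↦ R(exp tX)[f]` of `K_∞`-finite `Z(𝔤)`-finite vectors is the THEOREM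
`AutomorphicRepsGL.cuspidal_analyticAt_rightRegular_of_bounded` (`AutomorphicRepsGLAnalyticVectors`,
`…Holds`: Nelson's method, with `Z(𝔤)`-finiteness of automorphic forms in place of admissibility
and the Casimir identities of `RealCasimirGL`), on the base `{AutomorphicRepsGL.cuspidal_bounded}`
(Getz–Hahn 2024, Thm. 9.8.1), whence Step 3a (`formsOfL2_closure_exp_invariant_of_bounded`). The
conditional theorems of `AutomorphicRepsGLCuspidalL2Step3a` that consumed the fact were removed
with it. Should a route ever need Harish-Chandra's theorem for a general linear real group, the
statement to re-vendor is the one above (cites below), and the tree-internal proof route is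
Nelson's (`Literature.Analysis.OperatorTheory.NelsonSumOfSquares`,
`Literature.Analysis.OperatorTheory.OneParameterAnalyticVector`) once smoothness of `K`-finite
vectors is available.

## Design notes

* `restrictK` is an `abbrev` (so that `IsAdmissibleGK (restrictK G ϖ)` unfolds to the bare
  restricted action); no named fact, no instance, no `sorry`.
* Hypotheses on `A`, `N`, `G`, `E`, `ϖ` are the standing ones of `GKModules`.

## References

* Harish-Chandra, *Representations of a semisimple Lie group on a Banach space. I*, Trans. AMS 75
  (1953), 185–243: Lemma 31, Lemma 34 (p. 228), Thm. 4, Thm. 5 (p. 228), Thm. 6 (p. 230)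
  [HarishChandraTAMS1953] (held: doi:10.1090/s0002-9947-1953-0056610-2).
* M. Libine, *Introduction to Representations of Real Semisimple Lie Groups* (Schmid's course),
  arXiv:1212.2578: Def. 57, Thm. 58 (b), Cor. 66 and the remark following it, Thm. 72, Cor. 73
  [Libine2012] (held).
* A. W. Knapp, *Representation Theory of Semisimple Groups: An Overview Based on Examples*,
  Princeton Math. Ser. 36 (1986), Ch. VIII, §§2–3 [Knapp1986] (not held).
* E. Nelson, *Analytic vectors*, Ann. of Math. 70 (1959), 572–615 [Nelson1959] (not held).
* N. R. Wallach, *Real Reductive Groups I* (1988), §1.4.6, §1.6, §3.3.3, §3.4 [WallachRRG1]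
  (not held).
-/


-- Mathlib idiom (Mathlib/Algebra/Lie/OfAssociative.lean); needed to mention Lie subalgebras of matrix algebras
attribute [local instance 100] LieRing.ofAssociativeRing

open scoped MatrixGroups Matrix

noncomputable section

namespace Literature.NumberTheory.Automorphic

variable {A : Type*} [NormedCommRing A] [NormedAlgebra ℝ A] [NormedAlgebra ℚ A] [CompleteSpace A]
  [StarRing A] {N : Type*} [Fintype N] [DecidableEq N] (G : RealMatrixGroup A N)
  {E : Type*} [NormedAddCommGroup E] [InnerProductSpace ℂ E]
  (ϖ : ContRepresentation ℂ G.carrier E)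

/-- The **`K`-action underlying `ϖ`**: the restriction of `ϖ` to `K = G.maximalCompact = G ∩ U(N, A)`
as a bare representation of `K` on `E` (Mathlib `ContRepresentation.restrict` along `K ≤ G` and
`ContRepresentation.toRepresentation`). Wallach, §1.4.6 and §3.3.3. [folklore] -/
abbrev restrictK : Representation ℂ G.maximalCompact E :=
  (ϖ.restrict (Subgroup.inclusion G.maximalCompact_le_carrier)).toRepresentation

/-- `restrictK G ϖ k v = ϖ k v` (definitional). [folklore] -/
@[simp]
theorem restrictK_apply (k : G.maximalCompact) (v : E) :
    restrictK G ϖ k v = ϖ (Subgroup.inclusion G.maximalCompact_le_carrier k) v := rfl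

/-- The `K`-orbit span `kOrbitSpan G ϖ v` of `GKModules` is the span of the orbit of `v` under
`restrictK G ϖ` (definitional). [folklore] -/
theorem kOrbitSpan_eq_span_range_restrictK (v : E) :
    kOrbitSpan G ϖ v = Submodule.span ℂ (Set.range fun k : G.maximalCompact ↦ restrictK G ϖ k v) :=
  rfl

end Literature.NumberTheory.Automorphic
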